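import Mathlib
import HarnessLib
import Summits.HubbardSuperconductivity.HubbardSuperconductivity.Theorems.KLProgrammeKLRegimeTwoVolumeLipDoubledTruncDefs
import Summits.HubbardSuperconductivity.HubbardSuperconductivity.Theorems.KLProgrammeKLRegimeTwoVolumeSourceProfileKitF
import Summits.HubbardSuperconductivity.HubbardSuperconductivity.Theorems.KLProgrammeKLRegimeEngineTowerBlockIncrWtKitCarrier

/-!
# Route `KLProgramme` — crux K3 ENGINE (stmt-HubbardSuperconductivity-20437), stub (e) proof-input «(e)-D-ROWS», keying (A′), REKEY-D file D10T:
# THE N4⁺ SUPPLIER OF THE TRUNCATED DOUBLED TOWER — the measured size `klLipInputMeasDT` from E1's sector measured size and token #24 («PLAIN-TRACK-PROFILES»)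
# (seat hubbard-kl-k3c4-p1 g28; `--supports` 23356)

`klLipInputMeasDT V … d k j_w m = ⨆_{q,w} Σ_{s<3} klSrcPinnedSumAt V … (dk−1) j_w (dk) s m q w` (✓ DT0).  The `s = 0` species is E1's read-out
(✓ `TwoVolumeSource.klSrcPinnedSumAtF_zero_le_klWtPinnedSumAt` at `F = trivialMultiplier`, `≤ klTowerMeasWtAt V … d k j_w m`), the `s = 1, 2` species are token #24
`SourceProfilesAtLev V M S … (dk−1) j_w (dk)` by definition.  Hence:

* **`klLipInputMeasDT_le_of_sourceProfilesAtLev`** — `klLipInputMeasDT V … d k j_w m ≤ klTowerMeasWtAt V … d k j_w m + S 1 m + S 2 m` (`0 ≤ β`, `0 ≤ S 1 m`, `0 ≤ S 2 m`).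

So the assembly's N4⁺ majorant hypotheses (`hμι₁ hμι₂ hμι₃ hμprof` of ✓ `klLipBornDiffSupDT_le_law_of_rows_base1_boot`) are supplied, at each volume, by E1's W-law third conjunct
(the sector tower's `klTowerMeasWtAt`) plus the token-#24 budgets — the by-type producer hypothesis «PLAIN-TRACK-PROFILES» of the VL supplier census.  Bookkeeping; nothing asserted.
References: BGM 2006 §2.7 (2.70)–(2.71), §2.9 (4.3)–(4.8) [cite: BenfattoGiulianiMastropietro2006].
-/

noncomputable section

namespace Summit.HubbardSuperconductivity.HubbardSuperconductivity.Theorems.TwoVolumeLip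

set_option linter.dupNamespace false -- summit = problem name (single-conjunct summit), D-0017

open Finset Literature.MathematicalPhysics.QuantumLattice GrassmannAlgebra Literature.Probability.LatticeModels
open Literature.MathematicalPhysics.QuantumLattice.FermiRG
open Summit.HubbardSuperconductivity.HubbardSuperconductivity.Theorems.KLRegimeSplit
open Summit.HubbardSuperconductivity.HubbardSuperconductivity.Theorems.KLProgrammeLegKernels
open Summit.HubbardSuperconductivity.HubbardSuperconductivity.Theorems.EngineV8
open Summit.HubbardSuperconductivity.HubbardSuperconductivity.Theorems.TwoVolumeSource
open Summit.HubbardSuperconductivity.HubbardSuperconductivity.Theorems.TwoVolumeDefect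

section MeasOfSources

variable {V M : ℕ} [NeZero V]

/-- **N4⁺ from E1's measured size and token #24**: `klLipInputMeasDT V … d k j_w m ≤ klTowerMeasWtAt V … d k j_w m + S 1 m + S 2 m` under
`SourceProfilesAtLev V M S β U μ K (dk−1) j_w (dk)` (`0 ≤ β`, nonnegative budgets in degree `m`). [cite: BenfattoGiulianiMastropietro2006, §2.9 (4.3)-(4.8)] -/
theorem klLipInputMeasDT_le_of_sourceProfilesAtLev {β : ℝ} (hβ : 0 ≤ β) (U μ : ℝ) (K : TrigPolyC4v) (d k jw m : ℕ) {S : ℕ → ℕ → ℝ}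
    (hS1 : 0 ≤ S 1 m) (hS2 : 0 ≤ S 2 m) (hsrc : SourceProfilesAtLev V M S β U μ K (d * k - 1) jw (d * k)) :
    klLipInputMeasDT V M β U μ K d k jw m ≤ klTowerMeasWtAt V M β U μ K d k jw m + S 1 m + S 2 m := by
  have hT0 : 0 ≤ klTowerMeasWtAt V M β U μ K d k jw m := klTowerMeasWtAt_nonneg hβ U μ K d k jw m
  rw [klLipInputMeasDT]
  rcases isEmpty_or_nonempty (Fin m × SrcLabel V M (d * k - 1)) with h | h
  · rw [Real.iSup_of_isEmpty]; positivity
  · refine ciSup_le fun qw => ?_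
    rw [Finset.sum_range_succ, Finset.sum_range_succ, Finset.sum_range_one]
    refine add_le_add (add_le_add ?_ (hsrc.one m qw.1 qw.2)) (hsrc.two m qw.1 qw.2)
    calc klSrcPinnedSumAt V M β U μ K (d * k - 1) jw (d * k) 0 m qw.1 qw.2
        = klSrcPinnedSumAtF V M β U μ K (trivialMultiplier V M) (d * k - 1) jw (d * k) 0 m qw.1 qw.2 :=
          (klSrcPinnedSumAtF_trivial β U μ K _ _ _ 0 m qw.1 qw.2).symm
      _ ≤ klWtPinnedSumAt V M β μ K (d * k - 1) jw m (klEffectiveAction V M β U μ K klE0 (d * k)) qw.1 qw.2.1 :=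
          klSrcPinnedSumAtF_zero_le_klWtPinnedSumAt hβ U μ K _ _ _ _ m qw.1 qw.2
      _ ≤ klTowerMeasWtAt V M β U μ K d k jw m := klWtPinnedSumAt_le_klTowerMeasWtAt β U μ K d k jw m qw.1 qw.2.1

end MeasOfSources

end Summit.HubbardSuperconductivity.HubbardSuperconductivity.Theorems.TwoVolumeLip

end
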